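import Summits.KontsevichZagierPeriods.KontsevichZagierPeriods.Theorems.LinRedNormalFormMzvKernelInKZ
import Summits.KontsevichZagierPeriods.KontsevichZagierPeriods.Theorems.LinRedNormalFormHoffmanSpanInKZSpanTransfer

/-!
# `MzvKernelInKZ` (stmt-KontsevichZagierPeriods-3914) — the scoping, at Theorems level

Route `LinRedNormalForm`, crux `MzvKernelInKZ` (#4): the kernel of evaluation on the `ℤ`-span of
the MZV word representations `[Δ_w, q·∏ω_ε]` lies in `KZ.relations`. The route-repair of
2026-08-16 SCOPED this crux: `closes` derives it from the two items `HoffmanSpanInKZ` (#6,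
stmt-KontsevichZagierPeriods-15044, the motivic side: every word generator is congruent modulo
relations to a `ℤ`-combination of Hoffman generators) and `HoffmanIndependence` (#7,
stmt-KontsevichZagierPeriods-15045, the declared transcendence input). This file makes that
scoping a set of NAMED theorems about the route declarations, and shows it is EXACT:

* §1 `hoffmanKernel_of_hoffmanIndependence` — `HoffmanIndependence` implies the kernel statement
  on the Hoffman subgroup (closure of `⋃ w, hoffmanGens w`): a vanishing `ℤ`-combination of Hoffman
  generators is a relation (normal form over finitely supported rational coefficient vectors, the
  coefficient maps `q ↦ cls [Δ, q·ω_u]` being additive by integrand additivity; evaluation by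
  Kontsevich's formula; coefficients killed by independence).
* §2 `mzvKernelInKZ_iff_hoffmanKernel` — GIVEN `HoffmanSpanInKZ`, the crux is EQUIVALENT to that
  Hoffman-kernel statement; hence `mzvKernelInKZ_of_hoffmanSpanInKZ :
  HoffmanSpanInKZ → HoffmanIndependence → MzvKernelInKZ` (the Theorems-level twin of the `hKER`
  step of the route's `closes`).
* §3 `hoffmanSpanInKZ_of_mzvKernelInKZ` — conversely the crux implies `HoffmanSpanInKZ` given
  Brown's theorem `hoffmanSpan_eq_mzvSpace` (named fact, Brown 2012 Thm 1.1: the real Hoffman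
  values span), so that `mzvKernelInKZ_iff`: under Brown's theorem the crux is EXACTLY
  `HoffmanSpanInKZ ∧ (kernel on the Hoffman subgroup)`; nothing is lost by the scoping.
* §4 the line `two-posets-interior-landen` with its neighbouring crux discharged: item
  stmt-KontsevichZagierPeriods-3930 `HoffmanRelationInKZ` is proved in the tree
  (`hoffmanRelationInKZ_proof`), so the line's conditional theorem needs only the two classical
  conjectural inputs — `mzvKernelInKZ_of_edsComplete : EdsComplete → HoffmanIndependent →
  MzvKernelInKZ` and `mzvKernelInKZ_of_edsComplete_zagier : EdsComplete → ZagierConjecture →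
  hoffmanSpan_eq_mzvSpace → MzvKernelInKZ`; and `hoffmanSpanInKZ_of_edsComplete :
  EdsComplete → HoffmanSpanInKZ` (the all-weights form of crux 15044's spanning transfer).

Sources: M. Kontsevich, D. Zagier, *Periods* (2001), §1.2; D. Zagier, ECM 1992 (1994), §9;
F. Brown, *Mixed Tate motives over ℤ*, Ann. of Math. 175 (2012), Thm 1.1; K. Ihara, M. Kaneko,
D. Zagier, Compos. Math. 142 (2006), §1 (Conjecture 1); M. E. Hoffman, J. Algebra 194 (1997).
-/

noncomputable section

namespace Summit.KontsevichZagierPeriods.LinRedNormalForm.MzvKernelInKZ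

open Set MeasureTheory
open Literature.NumberTheory.Transcendental
open Summit.KontsevichZagierPeriods.MzvKernelInKZ.Negative
open Summit.KontsevichZagierPeriods.MzvKernelInKZ.TwoPosets
open Summit.KontsevichZagierPeriods.LinRedNormalForm.HoffmanSpanInKZ
  (hoffmanGens SpanAt hoffmanSpanInKZ_iff spanAt_of_edsCertificate zWord_bword_mem_hoffmanGens)
open Summit.KontsevichZagierPeriods.KontsevichZagierPeriods.Theses.LinRedNormalForm
  (MzvKernelInKZ HoffmanSpanInKZ HoffmanIndependence)

/-! ## §0 Read-backs and the Hoffman generators -/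

/-- The line's transcendence hypothesis `HoffmanIndependent` IS the route item
`HoffmanIndependence` (stmt-KontsevichZagierPeriods-15045), definitionally. -/
theorem hoffmanIndependent_iff : HoffmanIndependent ↔ HoffmanIndependence := Iff.rfl

/-- The Hoffman integrand `q'·∏ ω_{u}` is the word integrand of the binary word of `u`
(definitional unfolding of `KZ.mzvIntegrand`, `KZ.mzvForm`, `bword`). -/
theorem mul_mzvIntegrand_eq_wordFun (u : List ℕ) (q' : ℚ) (t : Fin (MZV.weight u) → ℝ) :
    (q' : ℝ) * KZ.mzvIntegrand u t = wordFun (bword (MZV.weight u) u) q' t := by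
  rw [wordFun_eq_mul_wordFun_one, wordFun_one_eq_prod_mzvForm]
  rfl

/-- Every Hoffman generator (any weight) is an MZV word generator of the crux. -/
theorem hoffmanGens_subset_genSet (w : ℕ) : hoffmanGens w ⊆ genSet := by
  rintro x ⟨u, q', s', -, hw, hd, hi, rfl⟩
  subst hw
  refine ⟨MZV.weight u, bword (MZV.weight u) u, q', s', hd, fun t ht => ?_, rfl⟩
  rw [hi ht]
  exact mul_mzvIntegrand_eq_wordFun u q' t

/-- Hence the Hoffman subgroup sits inside the crux's subgroup. -/
theorem closure_hoffmanGens_le :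
    AddSubgroup.closure (⋃ w, hoffmanGens w) ≤ AddSubgroup.closure genSet :=
  AddSubgroup.closure_mono (iUnion_subset hoffmanGens_subset_genSet)

/-- A Hoffman generator is congruent modulo relations to the canonical word representation of
its index with its coefficient. -/
theorem hoffmanGen_congr {u : List ℕ} (hu : MZV.IsHoffman u) {q' : ℚ}
    (s' : KZ.IntegralRep (MZV.weight u))
    (hd : s'.domain = {t | (∀ i, 0 < t i) ∧ (∀ i, t i < 1) ∧ StrictAnti t})
    (hi : EqOn s'.integrand (fun t => (q' : ℝ) * KZ.mzvIntegrand u t) s'.domain) :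
    KZ.of s' - KZ.of (wordRep (bword (MZV.weight u) u) q' (adm_bword hu.isAdmissible)) ∈
      KZ.relations :=
  of_sub_of_mem_relations_of_eqOn (by rw [wordRep_domain, hd]; rfl) fun t ht => by
    rw [wordRep_integrand, hi ht]
    exact mul_mzvIntegrand_eq_wordFun u q' t

/-- The value of the canonical word representation of a Hoffman index is its real MZV. -/
theorem value_wordRep_bword {u : List ℕ} (hu : MZV.IsHoffman u) :
    (wordRep (bword (MZV.weight u) u) 1 (adm_bword hu.isAdmissible)).value = multipleZeta u :=
  value_wordRep_eq_multipleZeta u hu.isAdmissible _ _ fun _ => rfl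

/-- Evaluation of the bracket of a Hoffman index read in its weight: `eval [Δ_w, q'·ω_u] = q'·ζ(u)`. -/
theorem eval_zWord_bword {w : ℕ} {u : List ℕ} (hu : MZV.IsHoffman u) (hw : MZV.weight u = w)
    (q' : ℚ) : KZ.eval (zWord w (bword w u) q') = (q' : ℝ) * multipleZeta u := by
  rw [zWord_bword_eq_zIdx hw, zIdx_of_adm hu.isAdmissible, KZ.eval_of, value_wordRep,
    value_wordRep_bword hu]

/-! ## §1 Independence of the real Hoffman values ⇒ the kernel on the Hoffman subgroup -/

/-- The Hoffman family as a word family for the transfer engine of `Negative/Transfer.lean`: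
index type the Hoffman indices, word of `u` = its binary word read in weight `|u|`. -/
theorem adm_bword_hoffman (u : {u : List ℕ // MZV.IsHoffman u}) :
    Adm (bword (MZV.weight u.1) u.1) :=
  adm_bword u.2.isAdmissible

/-- **Normal form on the Hoffman subgroup.** Every element of the subgroup generated by the
Hoffman generators is congruent modulo relations to the normal form of a finitely supported
rational coefficient vector on the Hoffman indices (`Negative.nfHom`: `l ↦ ∑_u cls [Δ, l(u)·ω_u]`,
additive because each coefficient map is, by integrand additivity). -/
theorem exists_nf_of_mem_closure_hoffmanGens {m : KZ.FormalRep}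
    (hm : m ∈ AddSubgroup.closure (⋃ w, hoffmanGens w)) :
    ∃ l : {u : List ℕ // MZV.IsHoffman u} →₀ ℚ,
      cls m = nfHom (fun u : {u : List ℕ // MZV.IsHoffman u} => bword (MZV.weight u.1) u.1)
        adm_bword_hoffman l := by
  induction hm using AddSubgroup.closure_induction with
  | mem x hx =>
    obtain ⟨w, hx⟩ := mem_iUnion.mp hx
    obtain ⟨u, q', s', hu, -, hd, hi, rfl⟩ := hx
    refine ⟨Finsupp.single ⟨u, hu⟩ q', ?_⟩
    rw [nfHom_apply, Finsupp.sum_single_index, cls_eq_cls_iff]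
    · exact hoffmanGen_congr hu s' hd hi
    · exact cls_eq_zero_iff.mpr (of_wordRep_zero_mem_relations _ _)
  | zero => exact ⟨0, by simp⟩
  | add x y _ _ ihx ihy =>
    obtain ⟨l₁, h₁⟩ := ihx
    obtain ⟨l₂, h₂⟩ := ihy
    exact ⟨l₁ + l₂, by rw [map_add, map_add, h₁, h₂]⟩
  | neg x _ ih =>
    obtain ⟨l, h⟩ := ih
    exact ⟨-l, by rw [map_neg, map_neg, h]⟩

/-- **§1 `HoffmanIndependence` ⇒ the kernel on the Hoffman subgroup lies in `KZ.relations`.**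
A vanishing `ℤ`-combination of Hoffman generators has a normal form `nfHom l` of value
`∑_u l(u)·ζ(u) = 0`; independence of the real Hoffman values gives `l = 0`, so the class is `0`. -/
theorem hoffmanKernel_of_hoffmanIndependence (hI : HoffmanIndependence) :
    ∀ c ∈ AddSubgroup.closure (⋃ w, hoffmanGens w), KZ.eval c = 0 → c ∈ KZ.relations := by
  intro c hc hc0
  obtain ⟨l, hl⟩ := exists_nf_of_mem_closure_hoffmanGens hc
  have hev : evalQ (nfHom (fun u : {u : List ℕ // MZV.IsHoffman u} => bword (MZV.weight u.1) u.1)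
      adm_bword_hoffman l) = 0 := by
    rw [← hl, evalQ_cls, hc0]
  rw [evalQ_nfHom] at hev
  have hl0 : l = 0 := by
    refine linearIndependent_iff.mp hI l ?_
    rw [Finsupp.linearCombination_apply]
    rw [← hev]
    refine Finsupp.sum_congr fun u _ => ?_
    rw [Rat.smul_def, value_wordRep_bword u.2]
  rw [hl0, map_zero, cls_eq_zero_iff] at hl
  exact hl

/-! ## §2 Given `HoffmanSpanInKZ`, the crux is the kernel on the Hoffman subgroup -/

/-- Additive extension of a congruence-to-a-subgroup statement from generators to the closure. -/
theorem exists_congr_of_mem_closure {S T : Set KZ.FormalRep} {c : KZ.FormalRep}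
    (hc : c ∈ AddSubgroup.closure S)
    (hS : ∀ x ∈ S, ∃ m ∈ AddSubgroup.closure T, x - m ∈ KZ.relations) :
    ∃ m ∈ AddSubgroup.closure T, c - m ∈ KZ.relations := by
  induction hc using AddSubgroup.closure_induction with
  | mem x hx => exact hS x hx
  | zero => exact ⟨0, zero_mem _, by simp⟩
  | add x y _ _ ihx ihy =>
    obtain ⟨m₁, hm₁, h₁⟩ := ihx
    obtain ⟨m₂, hm₂, h₂⟩ := ihy
    refine ⟨m₁ + m₂, add_mem hm₁ hm₂, ?_⟩
    have key := add_mem h₁ h₂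
    rwa [show x - m₁ + (y - m₂) = x + y - (m₁ + m₂) by abel] at key
  | neg x _ ih =>
    obtain ⟨m, hm, h⟩ := ih
    refine ⟨-m, neg_mem hm, ?_⟩
    have key := neg_mem h
    rwa [show -(x - m) = -x - -m by abel] at key

/-- `HoffmanSpanInKZ` extended additively: every element of the crux's subgroup is congruent
modulo relations to an element of the Hoffman subgroup. -/
theorem exists_hoffman_congr (hS : HoffmanSpanInKZ) {c : KZ.FormalRep}
    (hc : c ∈ AddSubgroup.closure genSet) :
    ∃ m ∈ AddSubgroup.closure (⋃ w, hoffmanGens w), c - m ∈ KZ.relations := by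
  refine exists_congr_of_mem_closure hc fun x hx => ?_
  obtain ⟨w, ε, q, s, hd, hi, rfl⟩ := hx
  obtain ⟨m, hm, h⟩ := (hoffmanSpanInKZ_iff.mp hS) w ε q s hd hi
  exact ⟨m, AddSubgroup.closure_mono (subset_iUnion hoffmanGens w) hm, h⟩

/-- **§2 Given `HoffmanSpanInKZ`, the crux `MzvKernelInKZ` is EQUIVALENT to the kernel statement
on the Hoffman subgroup.** (`→`: the Hoffman subgroup is a subgroup of the crux's; `←`: move a
vanishing combination into the Hoffman subgroup by `HoffmanSpanInKZ`, where its value is still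
`0` by soundness of the rules.) -/
theorem mzvKernelInKZ_iff_hoffmanKernel (hS : HoffmanSpanInKZ) :
    MzvKernelInKZ ↔
      ∀ c ∈ AddSubgroup.closure (⋃ w, hoffmanGens w), KZ.eval c = 0 → c ∈ KZ.relations := by
  refine ⟨fun h c hc hc0 => (crux_iff.mp h) c (closure_hoffmanGens_le hc) hc0, fun h => ?_⟩
  refine crux_iff.mpr fun c hc hc0 => ?_
  obtain ⟨m, hm, hcm⟩ := exists_hoffman_congr hS hc
  have hm0 : KZ.eval m = 0 := by
    have := (AddMonoidHom.mem_ker).1 (KZ.relations_le_ker_eval_holds hcm)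
    rwa [map_sub, hc0, zero_sub, neg_eq_zero] at this
  have key := add_mem hcm (h m hm hm0)
  rwa [sub_add_cancel] at key

/-- **The route's scoping as a theorem** (Theorems-level twin of the `hKER` step of `closes`):
items #6 `HoffmanSpanInKZ` (stmt-KontsevichZagierPeriods-15044) and #7 `HoffmanIndependence`
(stmt-KontsevichZagierPeriods-15045) imply the crux `MzvKernelInKZ`. -/
theorem mzvKernelInKZ_of_hoffmanSpanInKZ (hS : HoffmanSpanInKZ) (hI : HoffmanIndependence) :
    MzvKernelInKZ :=
  (mzvKernelInKZ_iff_hoffmanKernel hS).mpr (hoffmanKernel_of_hoffmanIndependence hI)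

/-- The Hoffman-kernel statement is a special case of the crux (unconditionally). -/
theorem hoffmanKernel_of_mzvKernelInKZ (h : MzvKernelInKZ) :
    ∀ c ∈ AddSubgroup.closure (⋃ w, hoffmanGens w), KZ.eval c = 0 → c ∈ KZ.relations :=
  fun c hc hc0 => (crux_iff.mp h) c (closure_hoffmanGens_le hc) hc0

/-! ## §3 Conversely: the crux and Brown's theorem give `HoffmanSpanInKZ` -/

/-- A word with admissible letters is the binary word of an admissible index of that weight
(the empty word for weight `0`). -/
theorem exists_index_of_adm' {a : ℕ} (ε : Fin a → Bool) (hε : Adm ε) :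
    ∃ (s : List ℕ), MZV.IsAdmissible s ∧ MZV.weight s = a ∧ MZV.binaryWord s = List.ofFn ε := by
  rcases Nat.eq_zero_or_pos a with rfl | ha
  · exact ⟨[], MZV.isAdmissible_nil, rfl, by simp [MZV.binaryWord]⟩
  · obtain ⟨s, hs, hw, hb⟩ := exists_index_of_adm ha ε hε
    exact ⟨s, hs, hw, hb⟩

/-- The value of a canonical word representation with admissible letters is a real MZV of the
same weight (Kontsevich's formula). -/
theorem value_wordRep_mem_mzvSpace {w : ℕ} (ε : Fin w → Bool) (hε : Adm ε) :
    (wordRep ε 1 hε).value ∈ mzvSpace w := by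
  obtain ⟨s, hs, hw, hb⟩ := exists_index_of_adm' ε hε
  subst hw
  refine Submodule.subset_span ⟨s, hs, rfl, ?_⟩
  refine value_wordRep_eq_multipleZeta s hs ε hε fun i => ?_
  rw [hb, List.getD_eq_getElem?_getD, List.getElem?_ofFn]
  simp

/-- **§3 The crux + Brown's theorem ⇒ `HoffmanSpanInKZ`.** For a word generator `[s]` with
admissible letters, Brown's `hoffmanSpan_eq_mzvSpace` writes its value `q·ζ(ε)` as a rational
combination `∑ᵢ q fᵢ·ζ(uᵢ)` of real Hoffman values of the same weight; the corresponding
combination `m = ∑ᵢ [Δ_w, q fᵢ·ω_{uᵢ}]` of Hoffman generators has the same value, so `[s] - m` is a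
vanishing element of the crux's subgroup, hence a relation by the crux. A generator with
non-admissible letters carries no representation unless it is a zero representation
(`Negative.of_mem_relations_of_not_adm`), and then `m = 0`. -/
theorem hoffmanSpanInKZ_of_mzvKernelInKZ (hB : hoffmanSpan_eq_mzvSpace) (h : MzvKernelInKZ) :
    HoffmanSpanInKZ := by
  refine hoffmanSpanInKZ_iff.mpr fun w ε q s hd hi => ?_
  by_cases hε : Adm ε
  · -- Brown: the value is a rational combination of Hoffman values of weight `w`
    have hval : (wordRep ε 1 hε).value ∈ hoffmanSpan w := by
      rw [hB w]; exact value_wordRep_mem_mzvSpace ε hε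
    obtain ⟨n, f, g, hsum⟩ := Submodule.mem_span_set'.mp hval
    have hg : ∀ i, ∃ u, MZV.IsHoffman u ∧ MZV.weight u = w ∧ (g i : ℝ) = multipleZeta u :=
      fun i => (g i).2
    choose u hu hw hgu using hg
    -- the Hoffman combination with the same value
    set m : KZ.FormalRep := ∑ i, zWord w (bword w (u i)) (q * f i) with hm
    have hmem : m ∈ AddSubgroup.closure (hoffmanGens w) :=
      sum_mem fun i _ => AddSubgroup.subset_closure (zWord_bword_mem_hoffmanGens (hu i) (hw i) _)
    have hevm : KZ.eval m = (q : ℝ) * (wordRep ε 1 hε).value := by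
      rw [hm, map_sum, ← hsum, Finset.mul_sum]
      refine Finset.sum_congr rfl fun i _ => ?_
      rw [eval_zWord_bword (hu i) (hw i), ← hgu i, Rat.cast_mul, Rat.smul_def]
      ring
    -- `[wordRep ε q] - m` is a vanishing element of the crux's subgroup, hence a relation
    have hdiff : KZ.of (wordRep ε q hε) - m ∈ KZ.relations := by
      refine (crux_iff.mp h) _ (sub_mem (of_wordRep_mem_closure ε q hε)
        (AddSubgroup.closure_mono ((subset_iUnion hoffmanGens w).trans
          (iUnion_subset hoffmanGens_subset_genSet)) hmem)) ?_
      rw [map_sub, KZ.eval_of, value_wordRep, hevm, sub_self]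
    refine ⟨m, hmem, ?_⟩
    have key := add_mem (of_sub_of_wordRep_mem_relations hε s hd hi) hdiff
    rwa [sub_add_sub_cancel] at key
  · exact ⟨0, zero_mem _, by simpa using of_mem_relations_of_not_adm s hd hi hε⟩

/-- **The scoping is exact.** Under Brown's theorem (`hoffmanSpan_eq_mzvSpace`, named fact) the
crux `MzvKernelInKZ` is EQUIVALENT to the conjunction of item #6 `HoffmanSpanInKZ` and the kernel
statement on the Hoffman subgroup (which item #7 `HoffmanIndependence` implies,
`hoffmanKernel_of_hoffmanIndependence`). -/
theorem mzvKernelInKZ_iff (hB : hoffmanSpan_eq_mzvSpace) :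
    MzvKernelInKZ ↔ HoffmanSpanInKZ ∧
      ∀ c ∈ AddSubgroup.closure (⋃ w, hoffmanGens w), KZ.eval c = 0 → c ∈ KZ.relations :=
  ⟨fun h => ⟨hoffmanSpanInKZ_of_mzvKernelInKZ hB h, hoffmanKernel_of_mzvKernelInKZ h⟩,
    fun h => (mzvKernelInKZ_iff_hoffmanKernel h.1).mpr h.2⟩

/-! ## §4 The line with its neighbouring crux discharged -/

/-- **All-weights spanning transfer** (crux 15044's `spanAt_of_edsCertificate` in every weight):
completeness of the EDS certificates gives `HoffmanSpanInKZ`. -/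
theorem hoffmanSpanInKZ_of_edsComplete (hE : EdsComplete) : HoffmanSpanInKZ :=
  hoffmanSpanInKZ_iff.mpr fun w => spanAt_of_edsCertificate (hE w)

/-- **The crux from the line's two remaining stubs**: `HoffmanRelationInKZ` (item 3930) being a
theorem of the tree, `MzvKernelInKZ_of_furusho` needs only EDS-completeness and Hoffman
independence. -/
theorem mzvKernelInKZ_of_edsComplete : EdsComplete → HoffmanIndependent → MzvKernelInKZ :=
  MzvKernelInKZ_of_furusho FurushoPentagon.HoffmanRelationInKZ.hoffmanRelationInKZ_proof

/-- The same through the route items: EDS-completeness ⇒ #6, and #6 ∧ #7 ⇒ the crux (a second,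
independent proof path: `hoffmanSpanInKZ_of_edsComplete` + `mzvKernelInKZ_of_hoffmanSpanInKZ`). -/
theorem mzvKernelInKZ_of_edsComplete' (hE : EdsComplete) (hI : HoffmanIndependence) :
    MzvKernelInKZ :=
  mzvKernelInKZ_of_hoffmanSpanInKZ (hoffmanSpanInKZ_of_edsComplete hE) hI

/-- **The crux from EDS-completeness and the tree's transcendence inputs**: Zagier's conjecture
(the open `ZagierConjecture`) and Brown's theorem (the named fact `hoffmanSpan_eq_mzvSpace`). -/
theorem mzvKernelInKZ_of_edsComplete_zagier :
    EdsComplete → ZagierConjecture → hoffmanSpan_eq_mzvSpace → MzvKernelInKZ :=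
  MzvKernelInKZ_of_zagier FurushoPentagon.HoffmanRelationInKZ.hoffmanRelationInKZ_proof

end Summit.KontsevichZagierPeriods.LinRedNormalForm.MzvKernelInKZ
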